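import Summits.Ventures.HodgeRepro2.T6NAut3
import Summits.Ventures.HodgeRepro2.T6N3Main2

/-!
# T6N3Main3 — the N3 isotypic step over the v3 carrier `NAut3` (the re-cut `data_adm'`)

Cell pub-hodge-repro2, Tier 6 (README §10), seat t6-p3 (N3 owner, M2). Proof lane; count-neutral.
The lead's v3 carrier `NAut3 F P` (T6NAut3, STATUS l. 11255 (3)) replaces v2's richness field
`data_adm` by `data_adm'` — «an N2-admissible quadruple with non-zero pairing is matched by an
admissible choice whose own Schwartz data have non-zero pairing» — after t6-p1's `T6N1Obstruction`
(p406480) showed the v1 / scaling-closed forms inconsistent with the N1 displays. This file is the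
N3-side check the lead asked for (l. 11255 (3)(a)): the v2 isotypic statement `N3Main.N3iso_main₂`
needs no change, and its NATIVE `NAut3` form is stated and proved here, with the same displays and
residual binders, together with the CHOICE form through `data_adm'`:
* `N3iso_main₃ (M : NAut3 F P) …` — `ℓ_A^σ ≢ 0 ∧ ℓ_B^σ ≢ 0 ⟹ ∃ (φ_a, φ_b, φ_c, φ_d)` N2-admissible
  with `⟨F_A, F_B⟩ ≠ 0` (the binder `hN3iso` of `periodInputN_of_mains₃`, verbatim);
* `N3iso_choice₃` — the same, composed with `NAut3.exists_choice_of_pairing_ne_zero`: an ADMISSIBLE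
  CHOICE `c` with `M.pairing c ≠ 0`;
* `N3iso_main₃_of_admSpanning`, `N3iso_main₃_of_univ`, `N3iso_main₃_stable` — the v2 variants,
  unchanged in shape;
* `N3iso_main₃_ofNAut2` — on a v2 carrier viewed as a v3 carrier (`NAut3.ofNAut2`) the native
  statement IS `N3iso_main₂` (the fields `d2`, `d3` are transported verbatim).
Displays consumed by name (through `T6N3Main2` / `T6N3Mult`): Rogawski 1990 §14.6 (the partition
sentence, Theorem 14.6.4, Theorem 14.6.5) on the packet carrier `R`, with the Π_s binder `hs` (the
record's residual [G-N3-3], class AD) and the dictionary `hRbr` (T6N3Bridge, class AD); residual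
binders (class AD, T6N3Interface): `hO`, `hst`, `hsimp`, `hPX`, `hPeqX`, `hPY`, `hPeqY`, `hσX`, `hσ`;
the sentence N2 and N3 share, `hAdm : M.d2.AdmGenerating` (class AD; outright on the toys).

§8(d): uses an L-value-free non-vanishing device: NO.
-/

namespace Summit.Ventures.HodgeRepro2.T6.N3Main

open scoped InnerProductSpace

variable {K : Type*} [Field K] [NumberField K] [NumberField.IsCMField K] {F : FaceSetting K}
  {P : NDatum F} (M : NAut3 F P)

/-- N3iso over the v3 carrier, DATA form with the N2-ADMISSIBLE witness: `ℓ_A^σ ≢ 0 ∧ ℓ_B^σ ≢ 0 ⟹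
∃ (φ_a, φ_b, φ_c, φ_d)` admissible data of the N2 datum with `⟨F_A, F_B⟩ ≠ 0` — the binder `hN3iso` of
the lead's `periodInputN_of_mains₃`, verbatim. Same displays and residual binders as `N3iso_main₂`. -/
theorem N3iso_main₃ (hAdm : M.d2.AdmGenerating) (R : RogawskiPackets)
    (hR0 : Hyp.Rogawski1990_Sec14_6_Partition R) (hR1 : Hyp.Rogawski1990_Thm14_6_4 R)
    (hR2 : Hyp.Rogawski1990_Thm14_6_5 R) (hs : ∀ P' ∈ R.Ps, ∀ π, R.mem π P' → R.m π ≤ 1)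
    (hst : M.d3.AutStable) (hRbr : M.d3.RogawskiBridge R hst) (hO : M.d3.AutOrthogonal)
    (hsimp : M.d3.AutSimple) (hPX : M.d3.ProductsIn20 M.d3.A)
    (hPeqX : M.d3.ProductEquivariant M.d3.A) (hPY : M.d3.ProductsIn20 M.d3.B)
    (hPeqY : M.d3.ProductEquivariant M.d3.B) (hσX : M.d3.SigmaIsAut M.d3.A)
    (hσ : M.d3.B.σ = M.d3.A.σ) :
    M.ellA → M.ellB →
      ∃ (φa : M.d3.A.Sa) (φb : M.d3.A.Sb) (φc : M.d3.B.Sa) (φd : M.d3.B.Sb),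
        M.AdmData (φa, φb, φc, φd) ∧ ⟪M.d3.B.F φc φd, M.d3.A.F φa φb⟫_ℂ ≠ 0 := by
  intro hA hB
  have hnon : M.d3.AutNonIso hst := hRbr (R.multLeOne_of_displays hR0 hR1 hR2 hs)
  exact M.d2.N3iso_of_datum₂_gen hAdm hO hst hsimp hnon hPX hPeqX hPY hPeqY hσX hσ hA hB

/-- THE CHOICE FORM over the v3 carrier: under N2's datum-level admissibility (`hN2 : M.AdmDatum`),
`ℓ_A^σ ≢ 0 ∧ ℓ_B^σ ≢ 0 ⟹` an ADMISSIBLE CHOICE `c` of the period datum with `pairing c ≠ 0` — the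
native N3 statement composed with the re-cut field `data_adm'` (`NAut3.exists_choice_of_pairing_ne_zero`). -/
theorem N3iso_choice₃ (hN2 : M.AdmDatum) (hAdm : M.d2.AdmGenerating) (R : RogawskiPackets)
    (hR0 : Hyp.Rogawski1990_Sec14_6_Partition R) (hR1 : Hyp.Rogawski1990_Thm14_6_4 R)
    (hR2 : Hyp.Rogawski1990_Thm14_6_5 R) (hs : ∀ P' ∈ R.Ps, ∀ π, R.mem π P' → R.m π ≤ 1)
    (hst : M.d3.AutStable) (hRbr : M.d3.RogawskiBridge R hst) (hO : M.d3.AutOrthogonal)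
    (hsimp : M.d3.AutSimple) (hPX : M.d3.ProductsIn20 M.d3.A)
    (hPeqX : M.d3.ProductEquivariant M.d3.A) (hPY : M.d3.ProductsIn20 M.d3.B)
    (hPeqY : M.d3.ProductEquivariant M.d3.B) (hσX : M.d3.SigmaIsAut M.d3.A)
    (hσ : M.d3.B.σ = M.d3.A.σ) :
    M.ellA → M.ellB → ∃ c, P.AdmChoice c ∧ M.pairing c ≠ 0 :=
  fun hA hB => M.exists_choice_of_pairing_ne_zero hN2
    (N3iso_main₃ M hAdm R hR0 hR1 hR2 hs hst hRbr hO hsimp hPX hPeqX hPY hPeqY hσX hσ hA hB)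

/-- `N3iso_main₃` under the STRONGER spanning sentence `M.d2.AdmSpanning`. -/
theorem N3iso_main₃_of_admSpanning (hAdm : M.d2.AdmSpanning) (R : RogawskiPackets)
    (hR0 : Hyp.Rogawski1990_Sec14_6_Partition R) (hR1 : Hyp.Rogawski1990_Thm14_6_4 R)
    (hR2 : Hyp.Rogawski1990_Thm14_6_5 R) (hs : ∀ P' ∈ R.Ps, ∀ π, R.mem π P' → R.m π ≤ 1)
    (hst : M.d3.AutStable) (hRbr : M.d3.RogawskiBridge R hst) (hO : M.d3.AutOrthogonal)
    (hsimp : M.d3.AutSimple) (hPX : M.d3.ProductsIn20 M.d3.A)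
    (hPeqX : M.d3.ProductEquivariant M.d3.A) (hPY : M.d3.ProductsIn20 M.d3.B)
    (hPeqY : M.d3.ProductEquivariant M.d3.B) (hσX : M.d3.SigmaIsAut M.d3.A)
    (hσ : M.d3.B.σ = M.d3.A.σ) :
    M.ellA → M.ellB →
      ∃ (φa : M.d3.A.Sa) (φb : M.d3.A.Sb) (φc : M.d3.B.Sa) (φd : M.d3.B.Sb),
        M.AdmData (φa, φb, φc, φd) ∧ ⟪M.d3.B.F φc φd, M.d3.A.F φa φb⟫_ℂ ≠ 0 :=
  N3iso_main₃ M (M.d2.admGenerating_of_admSpanning hAdm) R hR0 hR1 hR2 hs hst hRbr hO hsimp hPX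
    hPeqX hPY hPeqY hσX hσ

/-- `N3iso_main₃` with the sentence DISCHARGED: when the four admissible sets of the N2 datum are
everything, the binder `hAdm` is not needed (the toy case; note that such a carrier is exactly the one
t6-p1's `T6N1Obstruction2` rules out jointly with the N1 displays — the statement here is N3's alone). -/
theorem N3iso_main₃_of_univ (hA : M.d2.admA = Set.univ) (hB : M.d2.admB = Set.univ)
    (hC : M.d2.admC = Set.univ) (hD : M.d2.admD = Set.univ) (R : RogawskiPackets)
    (hR0 : Hyp.Rogawski1990_Sec14_6_Partition R) (hR1 : Hyp.Rogawski1990_Thm14_6_4 R)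
    (hR2 : Hyp.Rogawski1990_Thm14_6_5 R) (hs : ∀ P' ∈ R.Ps, ∀ π, R.mem π P' → R.m π ≤ 1)
    (hst : M.d3.AutStable) (hRbr : M.d3.RogawskiBridge R hst) (hO : M.d3.AutOrthogonal)
    (hsimp : M.d3.AutSimple) (hPX : M.d3.ProductsIn20 M.d3.A)
    (hPeqX : M.d3.ProductEquivariant M.d3.A) (hPY : M.d3.ProductsIn20 M.d3.B)
    (hPeqY : M.d3.ProductEquivariant M.d3.B) (hσX : M.d3.SigmaIsAut M.d3.A)
    (hσ : M.d3.B.σ = M.d3.A.σ) :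
    M.ellA → M.ellB →
      ∃ (φa : M.d3.A.Sa) (φb : M.d3.A.Sb) (φc : M.d3.B.Sa) (φd : M.d3.B.Sb),
        M.AdmData (φa, φb, φc, φd) ∧ ⟪M.d3.B.F φc φd, M.d3.A.F φa φb⟫_ℂ ≠ 0 :=
  N3iso_main₃_of_admSpanning M (M.d2.admSpanning_of_univ hA hB hC hD) R hR0 hR1 hR2 hs hst hRbr hO
    hsimp hPX hPeqX hPY hPeqY hσX hσ

/-- N3iso over the v3 carrier on the STABLE route (`M.d2.AdmStable`, `ℓ^σ ≢ 0` on admissible products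
on each side), as `N3iso_main₂_stable`. -/
theorem N3iso_main₃_stable (hAdmSt : M.d2.AdmStable) (R : RogawskiPackets)
    (hR0 : Hyp.Rogawski1990_Sec14_6_Partition R) (hR1 : Hyp.Rogawski1990_Thm14_6_4 R)
    (hR2 : Hyp.Rogawski1990_Thm14_6_5 R) (hs : ∀ P' ∈ R.Ps, ∀ π, R.mem π P' → R.m π ≤ 1)
    (hst : M.d3.AutStable) (hRbr : M.d3.RogawskiBridge R hst) (hO : M.d3.AutOrthogonal)
    (hsimp : M.d3.AutSimple) (hPX : M.d3.ProductsIn20 M.d3.A)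
    (hPeqX : M.d3.ProductEquivariant M.d3.A) (hPY : M.d3.ProductsIn20 M.d3.B)
    (hPeqY : M.d3.ProductEquivariant M.d3.B) (hσX : M.d3.SigmaIsAut M.d3.A)
    (hσ : M.d3.B.σ = M.d3.A.σ) (hA : M.d3.ellNonzeroOn M.d3.A M.d2.admA M.d2.admB)
    (hB : M.d3.ellNonzeroOn M.d3.B M.d2.admC M.d2.admD) :
    ∃ (φa : M.d3.A.Sa) (φb : M.d3.A.Sb) (φc : M.d3.B.Sa) (φd : M.d3.B.Sb),
      M.AdmData (φa, φb, φc, φd) ∧ ⟪M.d3.B.F φc φd, M.d3.A.F φa φb⟫_ℂ ≠ 0 :=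
  M.d2.N3iso_of_datum₂_stable hAdmSt hO hst hsimp
    (hRbr (R.multLeOne_of_displays hR0 hR1 hR2 hs)) hPX hPeqX hPY hPeqY hσX hσ hA hB

/-- On a v2 carrier viewed as a v3 carrier, the native statement is the v2 one: `NAut3.ofNAut2`
transports `d2` and `d3` verbatim, so `N3iso_main₃ (NAut3.ofNAut2 M₂)` and `N3iso_main₂ M₂` have the
same binders and the same conclusion (both sides of this equation are the same proposition). -/
theorem N3iso_main₃_ofNAut2 (M₂ : NAut2 F P) (hAdm : M₂.d2.AdmGenerating) (R : RogawskiPackets)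
    (hR0 : Hyp.Rogawski1990_Sec14_6_Partition R) (hR1 : Hyp.Rogawski1990_Thm14_6_4 R)
    (hR2 : Hyp.Rogawski1990_Thm14_6_5 R) (hs : ∀ P' ∈ R.Ps, ∀ π, R.mem π P' → R.m π ≤ 1)
    (hst : M₂.d3.AutStable) (hRbr : M₂.d3.RogawskiBridge R hst) (hO : M₂.d3.AutOrthogonal)
    (hsimp : M₂.d3.AutSimple) (hPX : M₂.d3.ProductsIn20 M₂.d3.A)
    (hPeqX : M₂.d3.ProductEquivariant M₂.d3.A) (hPY : M₂.d3.ProductsIn20 M₂.d3.B)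
    (hPeqY : M₂.d3.ProductEquivariant M₂.d3.B) (hσX : M₂.d3.SigmaIsAut M₂.d3.A)
    (hσ : M₂.d3.B.σ = M₂.d3.A.σ) :
    (NAut3.ofNAut2 M₂).ellA → (NAut3.ofNAut2 M₂).ellB →
      ∃ (φa : M₂.d3.A.Sa) (φb : M₂.d3.A.Sb) (φc : M₂.d3.B.Sa) (φd : M₂.d3.B.Sb),
        M₂.AdmData (φa, φb, φc, φd) ∧ ⟪M₂.d3.B.F φc φd, M₂.d3.A.F φa φb⟫_ℂ ≠ 0 :=
  N3iso_main₂ M₂ hAdm R hR0 hR1 hR2 hs hst hRbr hO hsimp hPX hPeqX hPY hPeqY hσX hσ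

end Summit.Ventures.HodgeRepro2.T6.N3Main
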